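import Literature.AlgebraicGeometry.HodgeTheory.HodgeConjectureDescendsAlongSurjections
import Literature.AlgebraicGeometry.HodgeTheory.SurjectivePullbackConiveauDescent
import Literature.AlgebraicGeometry.HodgeTheory.AlgebraicClassesPullback
import HarnessLib

/-!
# Along a surjection `g : X ↠ W` the Gysin morphism `g_*` maps the rational Hodge classes of `X` ONTO
# those of `W`, and — granted pull-back of algebraic classes — the algebraic classes onto the algebraic classes

Family `hodge`, layer `Literature/AlgebraicGeometry/HodgeTheory`; lane `lit-hodgefound` (Track 2 foundations,
Layer A1). THEOREMS ONLY (no definition, no named fact; D-0026).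

Voisin 2025, Cor. 2.12: «Let `H, H'` be Hodge structures of weight `2k`, with `H'` polarized, and let
`φ : H' → H` be a surjective morphism of Hodge structures. Then `φ : Hdg(H') → Hdg(H)` is surjective.» For a
SURJECTIVE morphism `g : X ⟶ W` of smooth projective complex varieties, `dim X = dim W + r`, the Gysin
morphism `g_* : H^{2(p+r)}(X)(r) → H^{2p}(W)` is such a surjection (Voisin I Lemma 7.28 transposed); the
tree proves the lift of the unit (`SurjectiveDescent.exists_hodgeClass_complexGysin_eq_one_of_surjective`:
a rational class `a` of type `(r, r)` with `g_* a = 1_W`) and uses it inside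
`SurjectiveDescent.hodgeConjectureFor_of_surjective`. This file records the surjectivity statements:

* §1 **`exists_isRationalClass_isOfHodgeType_complexGysin_eq_of_surjective`** — every rational class of
  type `(p, p)` on `W` is `g_*` of a rational class of type `(p + r, p + r)` on `X` (`y = g^* x ∪ a`,
  projection formula `g_*(g^* x ∪ a) = x ∪ g_* a = x`).
* §2 (granted the tree's named fact `fulton1998_map_mem_algebraicClasses` — pull-back preserves
  `Nᵖ H²ᵖ`, Fulton Cor. 19.2 (b) — as a hypothesis `hPull`)
  **`exists_mem_supportedClasses_complexGysin_eq_of_surjective`** — every algebraic class `x ∈ Nᵖ H²ᵖ(W)` is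
  `g_*` of an algebraic class `y ∈ N^{p+r} H^{2p+2r}(X)` (`y = c₀⁻¹ Lʳ_η(g^* x)`, `η` the rational Kähler class
  of a Kähler–rational datum: divisor cups raise the coniveau, `g_*(Lʳ_η g^* x) = c₀ • x`);
  `map_complexGysin_supportedClasses_le_algebraicClasses` (unconditional: `g_* N^{p+r} H^{2p+2r}(X) ⊆ Nᵖ H²ᵖ(W)`)
  and **`map_complexGysin_supportedClasses_eq_algebraicClasses_of_surjective`** (`=` granted `hPull`).

## References

* [Voisin2025] C. Voisin, Hodge and generalized Hodge conjectures, coniveau and algebraic cycles,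
  J. Open Math. Probl. 1 (2025), Prop. 2.11 and Cor. 2.12 (p. 11).
* [Voisin2002] [VoisinHodgeI2002] C. Voisin, Hodge Theory and Complex Algebraic Geometry I, CUP 2002,
  §7.3.2 Lemma 7.28, Remark 7.29, Lemma 7.30.
* [VoisinHodgeII2003] C. Voisin, Hodge Theory and Complex Algebraic Geometry II, CUP 2003, §9.2.4 Prop. 9.20,
  Prop. 9.21.
* [Fulton1998] W. Fulton, Intersection Theory, 2nd ed., Springer 1998, §19.2 Cor. 19.2 (b).
* [FultonYoungTableaux1997] W. Fulton, Young Tableaux, CUP 1997, Appendix B §B.1 (6).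
-/

noncomputable section

open CategoryTheory AlgebraicGeometry
open Literature.AlgebraicTopology.SingularHomology
open Literature.Geometry.Kaehler
open Literature.AlgebraicGeometry.Motives (IsSmoothProjective ComplexPoints)

namespace Literature.AlgebraicGeometry.HodgeTheory

variable {n m : ℕ} {X W : Motives.SchemeOver ℂ}

/-! ### §1 `g_*` maps the rational Hodge classes of `X` onto those of `W` -/

/-- **Every rational Hodge class of `W` is the Gysin image of a rational Hodge class of `X`** along a
surjective `g : X ⟶ W` of smooth projective complex varieties, `dim X = dim W + r`: for `x ∈ H²ᵖ(W(ℂ); ℂ)`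
rational of type `(p, p)` there is `y ∈ H^{2(p+r)}(X(ℂ); ℂ)` rational of type `(p + r, p + r)` with
`g_* y = x` — namely `y = g^* x ∪ a` for the Hodge unit lift `a` (`g_* a = 1_W`,
`SurjectiveDescent.exists_hodgeClass_complexGysin_eq_one_of_surjective`), by the projection formula
`g_*(g^* x ∪ a) = x ∪ g_* a` (Fulton App. B (6)). Voisin 2025 Cor. 2.12 for the surjective morphism of
polarized Hodge structures `g_*`. [cite: Voisin2025, Cor. 2.12 and Prop. 2.11]
[cite: Voisin2002, §7.3.2 Lemma 7.28, Remark 7.29 and Lemma 7.30] [cite: FultonYoungTableaux1997, Appendix B §B.1 (6)] -/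
theorem exists_isRationalClass_isOfHodgeType_complexGysin_eq_of_surjective (hX : IsSmoothProjective n X)
    (hW : IsSmoothProjective m W) (g : X ⟶ W) [Surjective g.left] {r : ℕ} (hr : m + r = n) {p : ℕ}
    {x : complexBetti W (2 * p)} (hx : IsRationalClass x) (hpp : IsOfHodgeType m W (2 * p) p p x) :
    ∃ y : complexBetti X (2 * (p + r)), IsRationalClass y ∧ IsOfHodgeType n X (2 * (p + r)) (p + r) (p + r) y ∧
      complexGysin complexOrientationFamily hX hW g (show 2 * (p + r) + 2 * m = 2 * p + 2 * n by omega) y = x := by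
  obtain ⟨a, ha, haH, ha1⟩ :=
    SurjectiveDescent.exists_hodgeClass_complexGysin_eq_one_of_surjective hX hW g hr (by omega)
  have h2 : 2 * p + 2 * r = 2 * (p + r) := by omega
  refine ⟨cupProduct h2 (complexBetti.map g (2 * p) x) a, (hx.map _).cup h2 ha,
    cupPreservesHodgeType_of_multiplicative_deRham
      (fun E _ _ _ ↦ Literature.NumberTheory.Transcendental.exists_deRhamIsoFamily_holds E) hX h2
      (hpp.map_of_isSmoothProjective hX hW g) haH, ?_⟩
  rw [complexGysin_cup (OrientationFamily.hasPoincareDuality complexOrientationFamily) hX hW g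
      (p := 2 * p) (q := 2 * r) (a := 2 * (p + r)) (b := 2 * p) (q' := 2 * 0)
      (by omega) (by omega) (by omega) (by omega), ha1, cupProduct_one]

/-! ### §2 `g_*` maps the algebraic classes of `X` onto those of `W` (granted pull-back of algebraic classes) -/

/-- **`g_* N^{p+r} H^{2p+2r}(X) ⊆ Nᵖ H²ᵖ(W)`** (unconditional: Gysin morphisms lower the codimension of
supports by the relative dimension, Voisin II Prop. 9.21 (ii); the tree's `complexGysin_mem_supportedClasses`).
[cite: VoisinHodgeII2003, §9.2.4 Prop. 9.21 (ii)] -/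
theorem map_complexGysin_supportedClasses_le_algebraicClasses (hX : IsSmoothProjective n X)
    (hW : IsSmoothProjective m W) (g : X ⟶ W) {r : ℕ} (hr : m + r = n) (p : ℕ) :
    (supportedClasses X (2 * p + 2 * r) (p + r)).map
        (complexGysin complexOrientationFamily hX hW g (show (2 * p + 2 * r) + 2 * m = 2 * p + 2 * n by omega)) ≤
      algebraicClasses W p := by
  rintro _ ⟨y, hy, rfl⟩
  exact complexGysin_mem_supportedClasses (gysinMap_restrictCompl_eq_zero_of_field ℂ)
    complexOrientationFamily hasPoincareDuality_complexOrientationFamily hX hW g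
    (show (2 * p + 2 * r) + 2 * m = 2 * p + 2 * n by omega) (r := p + r) (s := p) (by omega) hy

/-- **Every algebraic class of `W` is the Gysin image of an algebraic class of `X`, granted pull-back of
algebraic classes** (the tree's named fact `fulton1998_map_mem_algebraicClasses`, Fulton Cor. 19.2 (b), as the
hypothesis `hPull`): for `g : X ⟶ W` surjective, `dim X = dim W + r`, and `x ∈ Nᵖ H²ᵖ(W(ℂ); ℂ)` there is
`y ∈ N^{p+r} H^{2p+2r}(X(ℂ); ℂ)` with `g_* y = x` — namely `y = c₀⁻¹ Lʳ_η(g^* x)` (`g^* x` algebraic by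
`hPull`, `η` a divisor class so `Lʳ_η` raises the coniveau by `r`, `g_*(Lʳ_η g^* x) = c₀ • x` with `c₀ ≠ 0`).
[cite: Fulton1998, §19.2 Cor. 19.2 (b)] [cite: Voisin2002, §7.3.2 Lemma 7.28 and Remark 7.29]
[cite: VoisinHodgeII2003, §9.2.4 Prop. 9.20 and Prop. 9.21] -/
theorem exists_mem_supportedClasses_complexGysin_eq_of_surjective (hPull : fulton1998_map_mem_algebraicClasses)
    (hX : IsSmoothProjective n X) (hW : IsSmoothProjective m W) (g : X ⟶ W) [Surjective g.left] {r : ℕ}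
    (hr : m + r = n) {p : ℕ} {x : complexBetti W (2 * p)} (hx : x ∈ algebraicClasses W p) :
    ∃ y ∈ supportedClasses X (2 * p + 2 * r) (p + r),
      complexGysin complexOrientationFamily hX hW g (show (2 * p + 2 * r) + 2 * m = 2 * p + 2 * n by omega) y = x := by
  obtain ⟨D⟩ := nonempty_kaehlerRationalDatum hX
  obtain ⟨c₀, hc₀, hc⟩ := D.exists_complexGysin_lefschetzPow_map_eq_smul_of_surjective hX hW g hr
  have hgx : complexBetti.map g (2 * p) x ∈ algebraicClasses X p := hPull g hW hX p x hx
  refine ⟨c₀⁻¹ • lefschetzPow D.Hη r (2 * p) (complexBetti.map g (2 * p) x),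
    Submodule.smul_mem _ _ (lefschetzPow_mem_supportedClasses_add hX (D.ofRatClass_eta_mem_algebraicClasses hX) hgx r),
    ?_⟩
  rw [map_smul, hc (2 * p) x, smul_smul, inv_mul_cancel₀ hc₀, one_smul]

/-- **`g_* N^{p+r} H^{2p+2r}(X) = Nᵖ H²ᵖ(W)` along a surjection, granted pull-back of algebraic classes.**
[cite: Fulton1998, §19.2 Cor. 19.2 (b)] [cite: Voisin2002, §7.3.2 Lemma 7.28 and Remark 7.29]
[cite: VoisinHodgeII2003, §9.2.4 Prop. 9.21 (ii)] -/
theorem map_complexGysin_supportedClasses_eq_algebraicClasses_of_surjective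
    (hPull : fulton1998_map_mem_algebraicClasses) (hX : IsSmoothProjective n X) (hW : IsSmoothProjective m W)
    (g : X ⟶ W) [Surjective g.left] {r : ℕ} (hr : m + r = n) (p : ℕ) :
    (supportedClasses X (2 * p + 2 * r) (p + r)).map
        (complexGysin complexOrientationFamily hX hW g (show (2 * p + 2 * r) + 2 * m = 2 * p + 2 * n by omega)) =
      algebraicClasses W p := by
  refine le_antisymm (map_complexGysin_supportedClasses_le_algebraicClasses hX hW g hr p) fun x hx ↦ ?_
  obtain ⟨y, hy, hyx⟩ := exists_mem_supportedClasses_complexGysin_eq_of_surjective hPull hX hW g hr hx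
  exact ⟨y, hy, hyx⟩

end Literature.AlgebraicGeometry.HodgeTheory

end
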